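import Summits.NavierStokesRegularity.FluidComputer.PalasekTowerGermHostShadowedRun

/-!
# The germ host, CERTIFICATE-SIDE LETTER (currency-free): an exact free run that is `δ`-CLOSE to a
# field showing the four EXPLICIT readouts with margins `η + δ` meets the explicit letter of the crux
# `EpisodeBase`

Cell `ns-blowup`, seat `ns-blowup-fc-prover-3` (g9; D-0074 GROUP C «BRIDGE SUPPORT»; bears_on LADDER-NS N1,
route `PalasekTowerBreakdown`, crux `EpisodeBase` = item stmt-NavierStokesRegularity-19179, line `slot` v5:
registered stub `stub_explicit_slice_run : ExplicitSliceRun`). LABEL: E–C typing + kernel analysis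
(theorems only; no definition, no named fact, no `sorry`). WHAT THIS IS NOT: not Navier–Stokes evidence —
a transfer lemma for GIVEN objects; no run or field meeting the letter is exhibited; nothing about
`RungG 1` or blow-up.

## Why (refuter4 g8, K167 (R3): «the four readouts are the RIGHT certificate-side letter — reusable
## verbatim by any future door in currency (ii)/(iii); state them as a standalone conjunction lemma»)

The shadowed-run door (`LineGermData.exists_sliceRun_of_shadowedRun`, p511595) bundles two steps:
(a) a CLOSENESS CURRENCY — sup-norm Leray–Grönwall shadowing, which produces an exact free run within
`δ` of the reference, at the price `e^{36 C₀² (2M+1)² w₀}` (`defect_le_of_door_hypothesis`: closed in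
practice at the register's numbers); (b) the READOUT TRANSFER — an exact free run `δ`-close to a field
`w` whose cap / speed / finite-difference strain / core readouts carry margins `η + δ` meets the letter
with margin `η`, hence (free-run door p498061) the registered ∃-statement. Step (b) is currency-free:
an a-posteriori theory in energy currency (Dashti–Robinson / Chernyshenko–Constantin–Robinson–Titi,
fee `e^{∫‖∇w‖_∞}`, untyped on `ℝ³`) or a Newton–Kantorovich (radii-polynomial) enclosure would deliver
the same «exact run within `δ` of `w`» and plug into (b) unchanged. This file isolates (b):

* **`LineGermData.exists_sliceRun_of_near_freeRun`** — `d : LineGermData U ρ σ₀ ε₀ c₄`; an EXACT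
  classical finite-energy free run `(v, q)` on `[1, Host.τfirst]` from `v 1 = U` (existence supplied by
  the caller, in any currency); a field `w` on the register clock with `‖v(t,x) − w(t,x)‖ ≤ δ` on the
  window and `w(τfirst)` continuous; `η > 0`; the four EXPLICIT readouts of `w`: cap
  `‖w‖ ≤ (5/3)Y₁ − η − δ`, speed `Y₁ + η + δ ≤ ‖w(τfirst, x)‖` (`‖x‖ ≤ ρ`), finite-difference strain
  `(A₁ + η)‖x₁ − x₀‖ + 2δ < ‖w(τfirst, x₁) − w(τfirst, x₀)‖` (`x₀, x₁ ∈ B̄(0, ρ)`), core circulation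
  `≥ N₁^{β−2} + η + δ·8π/N₁` ⟹ the ∃-statement of `ExplicitSliceRun` verbatim;
* `LineGermData.freeRun_faces_of_near` — the same transfer with the conclusion the four faces OF THE
  EXACT RUN with margin `η` (the hypotheses of p498061), for callers that want the run, not the letter.

References: S. Palasek, arXiv:2605.13827 §4 [cite: Palasek2026ElementaryModel, §4]; M. Dashti,
J. C. Robinson, SIAM J. Numer. Anal. 46 (2008) [cite: DashtiRobinson2008, Thm. 5]; T. Tao, Anal. PDE 6
(2013) Thm. 5.4 [cite: Tao2011, Thm. 5.4 (ii)+(iv)].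
-/

noncomputable section

namespace Summit.NavierStokesRegularity.FluidComputer.PalasekTowerClayBridge.Germ

open Set Function Filter Topology InnerProductSpace Metric MeasureTheory
open scoped Topology ContDiff RealInnerProductSpace ENNReal NNReal
open Literature.Analysis Literature.Analysis.FluidPDE

namespace LineGermData

variable {U : EuclideanSpace ℝ (Fin 3) → EuclideanSpace ℝ (Fin 3)} {ρ σ₀ ε₀ c₄ : ℝ}
  (d : LineGermData U ρ σ₀ ε₀ c₄)
include d

omit d in
/-- **READOUT TRANSFER (currency-free).** Let `(v, q)` be a classical solution (any force, any
viscosity: only the smoothness of the final slice is used) on `[1, Host.τfirst]`, `w` a field with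
`‖v(t,x) − w(t,x)‖ ≤ δ` on the window and `w(τfirst)` continuous, `η > 0`. If `w` shows the cap
`≤ (5/3)Y₁ − η − δ`, the speed `≥ Y₁ + η + δ` at some `‖x‖ ≤ ρ`, the finite-difference strain
`(A₁ + η)‖x₁ − x₀‖ + 2δ < ‖w(τfirst,x₁) − w(τfirst,x₀)‖` with `x₀, x₁ ∈ B̄(0,ρ)`, and a core loop of
circulation `≥ N₁^{β−2} + η + δ·8π/N₁`, then THE EXACT RUN shows the four faces with margin `η`: cap
`≤ (5/3)Y₁ − η`, speed `≥ Y₁ + η`, strain `‖Dv(τfirst)‖ ≥ A₁ + η` at some point of `B̄(0,ρ)`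
(mean-value inequality, `exists_mem_segment_lt_norm_fderiv`), core `≥ N₁^{β−2} + η`.
[cite: Palasek2026ElementaryModel, §4] -/
theorem freeRun_faces_of_near {ν : ℝ}
    {v w f : ℝ → EuclideanSpace ℝ (Fin 3) → EuclideanSpace ℝ (Fin 3)} {q : ℝ → EuclideanSpace ℝ (Fin 3) → ℝ}
    {δ η : ℝ}
    (hv : IsClassicalNSSolutionOn (Icc 1 Host.τfirst) ν f v q)
    (hnear : ∀ t ∈ Icc (1 : ℝ) Host.τfirst, ∀ x, ‖v t x - w t x‖ ≤ δ)
    (hwc : Continuous (w Host.τfirst))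
    (hcap : ∀ t ∈ Icc (1 : ℝ) Host.τfirst, ∀ x, ‖w t x‖ ≤ 5 / 3 * TowerRates.wide.Y 1 - η - δ)
    (hspeed : ∃ x, ‖x‖ ≤ ρ ∧ TowerRates.wide.Y 1 + η + δ ≤ ‖w Host.τfirst x‖)
    (hstrain : ∃ x₀ x₁, ‖x₀‖ ≤ ρ ∧ ‖x₁‖ ≤ ρ ∧
      (TowerRates.wide.A 1 + η) * ‖x₁ - x₀‖ + 2 * δ < ‖w Host.τfirst x₁ - w Host.τfirst x₀‖)
    (hcore : ∃ (x : EuclideanSpace ℝ (Fin 3)) (γ : ℝ → EuclideanSpace ℝ (Fin 3)),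
      ‖x‖ ≤ ρ ∧ ContDiff ℝ 1 γ ∧ γ 0 = γ 1 ∧
      (∀ s ∈ Icc (0 : ℝ) 1, γ s ∈ closedBall x (1 / TowerRates.wide.N 1)) ∧
      (∀ s ∈ Icc (0 : ℝ) 1, ‖deriv γ s‖ ≤ 8 * Real.pi / TowerRates.wide.N 1) ∧
      TowerRates.wide.N 1 ^ (TowerRates.wide.β - 2) + η + δ * (8 * Real.pi / TowerRates.wide.N 1) ≤
        circulation (w Host.τfirst) γ) :
    (∀ t ∈ Icc (1 : ℝ) Host.τfirst, ∀ x, ‖v t x‖ ≤ 5 / 3 * TowerRates.wide.Y 1 - η) ∧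
    (∃ x, ‖x‖ ≤ ρ ∧ TowerRates.wide.Y 1 + η ≤ ‖v Host.τfirst x‖) ∧
    (∃ x, ‖x‖ ≤ ρ ∧ TowerRates.wide.A 1 + η ≤ ‖fderiv ℝ (v Host.τfirst) x‖) ∧
    (∃ (x : EuclideanSpace ℝ (Fin 3)) (γ : ℝ → EuclideanSpace ℝ (Fin 3)),
      ‖x‖ ≤ ρ ∧ ContDiff ℝ 1 γ ∧ γ 0 = γ 1 ∧
      (∀ s ∈ Icc (0 : ℝ) 1, γ s ∈ closedBall x (1 / TowerRates.wide.N 1)) ∧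
      (∀ s ∈ Icc (0 : ℝ) 1, ‖deriv γ s‖ ≤ 8 * Real.pi / TowerRates.wide.N 1) ∧
      TowerRates.wide.N 1 ^ (TowerRates.wide.β - 2) + η ≤ circulation (v Host.τfirst) γ) := by
  have hτ1 : (1 : ℝ) ≤ Host.τfirst := by rw [Host.τfirst_eq]; linarith [Host.wfirst_pos]
  have hτmem : Host.τfirst ∈ Icc (1 : ℝ) Host.τfirst := ⟨hτ1, le_rfl⟩
  set T := Host.τfirst with hT_def
  refine ⟨?_, ?_, ?_, ?_⟩
  · -- the cap
    intro t ht x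
    have h1 := hnear t ht x
    have h2 := hcap t ht x
    calc ‖v t x‖ = ‖w t x + (v t x - w t x)‖ := by rw [add_sub_cancel]
      _ ≤ ‖w t x‖ + ‖v t x - w t x‖ := norm_add_le _ _
      _ ≤ 5 / 3 * TowerRates.wide.Y 1 - η := by linarith
  · -- the speed floor
    obtain ⟨x, hx, hfl⟩ := hspeed
    refine ⟨x, hx, ?_⟩
    have h1 := hnear T hτmem x
    have h2 : ‖w T x‖ ≤ ‖v T x‖ + ‖v T x - w T x‖ := by
      calc ‖w T x‖ = ‖v T x - (v T x - w T x)‖ := by rw [sub_sub_cancel]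
        _ ≤ ‖v T x‖ + ‖v T x - w T x‖ := norm_sub_le _ _
    have h3 : TowerRates.wide.Y 1 + η + δ ≤ ‖w T x‖ := hfl
    linarith
  · -- the strain floor, by the finite difference and the mean-value inequality
    obtain ⟨x₀, x₁, hx₀, hx₁, hfd⟩ := hstrain
    have h0 := hnear T hτmem x₀
    have h1 := hnear T hτmem x₁
    have hsplit : ‖w T x₁ - w T x₀‖ ≤ ‖v T x₁ - v T x₀‖ + (‖v T x₁ - w T x₁‖ + ‖v T x₀ - w T x₀‖) := by
      have hid : w T x₁ - w T x₀ = (v T x₁ - v T x₀) - ((v T x₁ - w T x₁) - (v T x₀ - w T x₀)) := by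
        abel
      rw [hid]
      exact (norm_sub_le _ _).trans (add_le_add le_rfl (norm_sub_le _ _))
    have hlt : (TowerRates.wide.A 1 + η) * ‖x₁ - x₀‖ < ‖v T x₁ - v T x₀‖ := by
      have : (TowerRates.wide.A 1 + η) * ‖x₁ - x₀‖ + 2 * δ < ‖w T x₁ - w T x₀‖ := hfd
      linarith
    have hdiff : ∀ x ∈ segment ℝ x₀ x₁, DifferentiableAt ℝ (v T) x := fun x _ =>
      ((hv.contDiff_velocity hτmem).differentiable (by norm_cast)).differentiableAt
    obtain ⟨x, hxseg, hAx⟩ := exists_mem_segment_lt_norm_fderiv hdiff hlt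
    have hxball : x ∈ closedBall (0 : EuclideanSpace ℝ (Fin 3)) ρ :=
      (convex_closedBall (0 : EuclideanSpace ℝ (Fin 3)) ρ).segment_subset
        (mem_closedBall_zero_iff.2 hx₀) (mem_closedBall_zero_iff.2 hx₁) hxseg
    exact ⟨x, mem_closedBall_zero_iff.1 hxball, hAx.le⟩
  · -- the core loop
    obtain ⟨x, γ, hx, hγ, hγ01, hγball, hγspeed, hcirc⟩ := hcore
    refine ⟨x, γ, hx, hγ, hγ01, hγball, hγspeed, ?_⟩
    have hcv : Continuous (v T) := (hv.contDiff_velocity hτmem).continuous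
    have hnear' : ∀ s ∈ Icc (0 : ℝ) 1, ‖v T (γ s) - w T (γ s)‖ ≤ δ := fun s _ => hnear T hτmem (γ s)
    have h1 := circulation_sub_le_of_near hwc hcv hγ hγspeed hnear'
    linarith

/-- **THE CERTIFICATE-SIDE LETTER (currency-free door).** Let `d : LineGermData U ρ σ₀ ε₀ c₄`; let
`(v, q)` be an EXACT classical finite-energy solution of the UNFORCED system (`ν = 1`) on
`[1, Host.τfirst]` from `v 1 = U` — its existence supplied by the caller in any currency (sup-norm
shadowing p509799, an energy-class a-posteriori theory, a Newton–Kantorovich enclosure, or a pen-and-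
paper construction); let `w` be a field with `‖v(t,x) − w(t,x)‖ ≤ δ` on the window and `w(τfirst)`
continuous; `η > 0`. If `w` shows the four EXPLICIT readouts — cap `≤ (5/3)Y₁ − η − δ`, speed
`≥ Y₁ + η + δ` at some `‖x‖ ≤ ρ`, finite-difference strain `(A₁ + η)‖x₁ − x₀‖ + 2δ <
‖w(τfirst,x₁) − w(τfirst,x₀)‖` (`x₀, x₁ ∈ B̄(0,ρ)`), core circulation `≥ N₁^{β−2} + η + δ·8π/N₁` —
then the ∃-statement of the registered stub `ExplicitSliceRun` of the line `slot` holds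
(`freeRun_faces_of_near`, then the free-run door p498061). [cite: Palasek2026ElementaryModel, §4]
[cite: Tao2011, Thm. 5.4 (ii)+(iv)] -/
theorem exists_sliceRun_of_near_freeRun
    {v w : ℝ → EuclideanSpace ℝ (Fin 3) → EuclideanSpace ℝ (Fin 3)} {q : ℝ → EuclideanSpace ℝ (Fin 3) → ℝ}
    {δ η : ℝ}
    (hv : IsClassicalNSSolutionOn (Icc 1 Host.τfirst) 1 0 v q) (hv1 : v 1 = U)
    (hvE : ∃ C : ℝ≥0∞, C < ⊤ ∧ ∀ t ∈ Icc (1 : ℝ) Host.τfirst, ∫⁻ x, ‖v t x‖ₑ ^ 2 ≤ C)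
    (hnear : ∀ t ∈ Icc (1 : ℝ) Host.τfirst, ∀ x, ‖v t x - w t x‖ ≤ δ)
    (hwc : Continuous (w Host.τfirst)) (hη : 0 < η)
    (hcap : ∀ t ∈ Icc (1 : ℝ) Host.τfirst, ∀ x, ‖w t x‖ ≤ 5 / 3 * TowerRates.wide.Y 1 - η - δ)
    (hspeed : ∃ x, ‖x‖ ≤ ρ ∧ TowerRates.wide.Y 1 + η + δ ≤ ‖w Host.τfirst x‖)
    (hstrain : ∃ x₀ x₁, ‖x₀‖ ≤ ρ ∧ ‖x₁‖ ≤ ρ ∧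
      (TowerRates.wide.A 1 + η) * ‖x₁ - x₀‖ + 2 * δ < ‖w Host.τfirst x₁ - w Host.τfirst x₀‖)
    (hcore : ∃ (x : EuclideanSpace ℝ (Fin 3)) (γ : ℝ → EuclideanSpace ℝ (Fin 3)),
      ‖x‖ ≤ ρ ∧ ContDiff ℝ 1 γ ∧ γ 0 = γ 1 ∧
      (∀ s ∈ Icc (0 : ℝ) 1, γ s ∈ closedBall x (1 / TowerRates.wide.N 1)) ∧
      (∀ s ∈ Icc (0 : ℝ) 1, ‖deriv γ s‖ ≤ 8 * Real.pi / TowerRates.wide.N 1) ∧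
      TowerRates.wide.N 1 ^ (TowerRates.wide.β - 2) + η + δ * (8 * Real.pi / TowerRates.wide.N 1) ≤
        circulation (w Host.τfirst) γ) :
    ∃ (U' : EuclideanSpace ℝ (Fin 3) → EuclideanSpace ℝ (Fin 3)) (ρ' σ₀' ε c₄' : ℝ)
      (_ : LineGermData U' ρ' σ₀' ε c₄')
      (v' : ℝ → EuclideanSpace ℝ (Fin 3) → EuclideanSpace ℝ (Fin 3)) (r : ℝ → EuclideanSpace ℝ (Fin 3) → ℝ),
      IsClassicalNSSolutionOn (Icc 1 Host.τfirst) 1 (lineForce U' σ₀' ε) v' r ∧ v' 1 = U' ∧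
      (∃ C : ℝ≥0∞, C < ⊤ ∧ ∀ t ∈ Icc (1 : ℝ) Host.τfirst, ∫⁻ x, ‖v' t x‖ₑ ^ 2 ≤ C) ∧
      (∀ t ∈ Icc (1 : ℝ) Host.τfirst, ∀ x, ‖v' t x‖ ≤ 5 / 3 * TowerRates.wide.Y 1) ∧
      (∃ x, ‖x‖ ≤ ρ' ∧ TowerRates.wide.Y 1 ≤ ‖v' Host.τfirst x‖) ∧
      (∃ x, ‖x‖ ≤ ρ' ∧ TowerRates.wide.A 1 ≤ ‖fderiv ℝ (v' Host.τfirst) x‖) ∧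
      (∃ (x : EuclideanSpace ℝ (Fin 3)) (γ : ℝ → EuclideanSpace ℝ (Fin 3)),
        ‖x‖ ≤ ρ' ∧ ContDiff ℝ 1 γ ∧ γ 0 = γ 1 ∧
        (∀ s ∈ Icc (0 : ℝ) 1, γ s ∈ closedBall x (1 / TowerRates.wide.N 1)) ∧
        (∀ s ∈ Icc (0 : ℝ) 1, ‖deriv γ s‖ ≤ 8 * Real.pi / TowerRates.wide.N 1) ∧
        TowerRates.wide.N 1 ^ (TowerRates.wide.β - 2) ≤ circulation (v' Host.τfirst) γ) := by
  obtain ⟨hcap', hspeed', hstrain', hcore'⟩ :=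
    freeRun_faces_of_near (ρ := ρ) hv hnear hwc hcap hspeed hstrain hcore
  exact d.exists_sliceRun_of_freeRun hv hv1 hvE hη hcap' hspeed' hstrain' hcore'

end LineGermData

end Summit.NavierStokesRegularity.FluidComputer.PalasekTowerClayBridge.Germ

end
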